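import Summits.QuantumFields.BalabanUV.T4Continuum.Support.NE9FutureProfileEndOfRecordSP
import Summits.QuantumFields.BalabanUV.T4Continuum.Support.NE9FutureProfileStepOffCentre
import Summits.QuantumFields.BalabanUV.T4Continuum.Support.NE9PolydiscChainOffCentre

/-!
# NE9FutureProfileEndOfRecordOffCentre — route R4♯-T's END OF RECORD: `NE9 ∧ FadingMemory` at an OFF-CENTRE admissible rate `μ`
# (prefactor `1∕(1−θ²)`) from the END of record's binders with the slice map's (Φ-size) booked OFF-CENTRE — the generic
# END-half of piece (T-c), composing (T-a) `NE9PolydiscChainOffCentre.chainLipschitz_of_holoMaps_offCentre` (leaf lineage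
# `…-leaf-03` gen 44) with (T-b) `NE9FutureProfileStepOffCentre.holoMaps_step_offCentre` (leaf lineage `…-leaf-04` gen 50,
# p260446) inside this lineage's chain-generic END `NE9FutureProfileEndOfRecordSP.ne9_and_fadingMemory_of_holoSlice_injRead_of_chain`
# (p256694 §1)

Cell `pub-balaban`, T4-DAG §6 NE9; NE9 crux team (coordinator ruling «YM REDIRECT» e34b3e0c (2)); leaf lineage
`b2b-balaban-t4-ne9-formalise-leaf-05` generation 51; route R4♯-T of `t4/ROUTES-NE9.md` v9.0.1 (rank 1).  Filed on the BINDER-row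
OWNER's word (lineage `b2b-balaban-t4-ne9-p1` gen 62, CLAIMS.log 2026-08-21T10:02:49Z (W4): «ACCEPTED FOR THE END HALF — (T-c) END
→ leaf-05: the generic END-of-record off-centre wrapper … `…_injRead_of_chain` at `hchain :=` leaf-03 §6 ∘ leaf-04 §4∕§5, centred
consequence `B₀ := P₀ + B₁` and total room DERIVED; file name … `Support/NE9FutureProfileEndOfRecordOffCentre.lean` preferred») and
the refuter's pricing (PRICING-NE9 v10 §E, F-v10-4 ∕ Q-v10-1 «no obstruction»).  The RECORD half of (T-c) — the clause
`NE9HoloFamilyOffCentre.vacSlice_offCentre_of_potentialKPG` (history-free centre = the `explZ` part, `B₁ = 2B`, `cbar₀ = p̄₀`) and the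
instance-level END at `Ψ := ΨOf` — is the OWNER lineage's and docks HERE by name (§2 ∕ §3); it is not touched by this file.

HONEST FRAMING (T4-DAG PAGE 1).  Rung (B)+1 of the FINITE-VOLUME T⁴ programme — NOT infinite volume, NOT a mass gap, NOT the Clay
problem.  NE9 (`T4OutputRate.NE9` ∧ `FadingMemory`) is a cell NEW ESTIMATE, NOT PRINTED in [I] = [Balaban1987RG1] (CMP **109**), [II] =
[Balaban1988RG2Cluster] (CMP **116**), and NOT PROVED for Bałaban's E^{(j)}: every theorem below is «NE9 ⇐ the named binders» for an
ABSTRACT functional `E` carrying EXACTLY the END of record's structural binders plus ONE complex slice map `ΦY` with the displayed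
clauses (Φ-holo) ∕ off-centre (Φ-size) ∕ (Φ-real) — the INSTANCE ((R-0)[scope] on the box, the reality clause, the coupling half, the
record clause (T-c)) and the model O-NE9-1 (wall W1) UNTOUCHED; spine PROVED 0∕9.  A sharper RATE inside a CONDITIONAL END is not
progress on the estimate itself (refuter: rate-only ∕ cell-neutral).  HONEST DEPENDENCY (cell line, verbatim): continuum YM on T⁴ ⇐
BetaPertH ∧ nine spine estimates (0/9 proved); BetaPertH ⇐ (D1) ∧ (D4) ∧ CAP+tail; G-an2-4 gates asym, D1 and NE2/3/4.
`FlowStep.BetaPertH`, (B), (B^μ) do not occur.  Composition over generic kernels; no `def`, no Prop-valued definition; [I]∕[II] for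
TYPES∕loci only (ABSOLUTE RULE); 0 sorry.

WHAT.  K2♭'s END of record (`…_injRead_SP`, rate `θ`) spends the whole size `B₀` of the slice map on the RADIUS of a CENTRED image ball.
If the slice map `ΦY k (g k)` maps the table ball `B(0,r)` into an OFF-CENTRE ball `B̄(cY k g, B₁)` with `‖cY k g‖ ≤ cbar₀` (on the
record: `cY` = the table-free `explZ` part, [II] p. 21 l. 23–31 «½E₀», TYPES only), then by (T-b) the ambient step maps `B(0,r)` into
`B̄((τ₀•cY k g, J k (cY k g)), r₄)` for any `r₄ ≥ ω̂·r + τ₀·B₁`, centres of norm `≤ τ₀·cbar₀ ≤ c̄`, and by (T-a) the chain is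
`(1∕(1−θ²))·μⁿ`-Lipschitz on `B̄(0,θr)` for every rate `μ` ADMISSIBLE for `(r, c̄, r₄)` — `(r₄² − ρ²)·r ≤ μ·r₄·(r² − (c̄ + ρ)²)` on
`ρ ∈ [0, r₄]` — whenever `c̄ + r₄ ≤ θ·r`, `θ < 1`.  Fed into §1 of `NE9FutureProfileEndOfRecordSP` (ANY chain estimate), with the
END's centred (Φ-size) at `B₀ := cbar₀ + B₁` and its room `ω̂·r + τ₀·(cbar₀ + B₁) ≤ θ·r` DERIVED from the split rooms, this gives
`NE9 E W κ (prodModuli (1∕(1−θ²)·ℓ) (fun _ ↦ μ)) ∧ FadingMemory (1∕(1−θ²)·ℓ∕μ) μ (…)` — rate letter `θ ↦ μ` (`μ ≤ θ` available, `< θ`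
as soon as `cbar₀ > 0`; `0 < μ` is a consequence, `NE9PolydiscStepOffCentre.rate_pos`).
* §1 **`ne9_and_fadingMemory_of_holoSlice_injRead_offCentre`** — THE KERNEL FACE: `…_injRead_SP`'s binder list with (Φ-size) `hΦb`
  REPLACED by the off-centre family datum `(cY, hΦoff, hcY)`, `hB₀` by `(hB₁, hcbar₀)`, `hθ0` dropped, the room by the SPLIT rooms
  `hr₄ : ω̂·r + τ₀·B₁ ≤ r₄`, `hcbar : τ₀·cbar₀ ≤ c̄`, `hθ : c̄ + r₄ ≤ θ·r`, plus the interval test `hμ`; every other binder VERBATIM.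
* §2 **`…_offCentre_free`** — HISTORY-FREE centres `cY : ℕ → 𝔜`, `‖cY k‖ ≤ cbar₀` (the record's case, OWNER g62 (W3)∕(W4)).
* §3 **`…_offCentre_split`** — the same in the NORMALISED split-room letters of the owner's announced §2 ∕ the refuter's §E:
  `ω̂·r + τ₀·B₁ ≤ t·r`, `τ₀·cbar₀ ≤ c̄·r`, `c̄ + t = θ`, interval test at `(r, c̄·r, t·r)`; history-free centres.
* §3′ **`…_offCentre_sharp_split`** — §3 at `τ₀ := τ̄` with `hRd := norm_RdAmb_le_geometric_sharp` supplied (as `…_sharp_SP` is to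
  `…_injRead_SP`): THE OWNER's RE-DOCK POINT for the off-centre twin of E134 §2 (`exact …_sharp_SP ↦ exact …_offCentre_sharp_split`).
* §4 **`…_offCentre_quadTest`** — §3 with the interval test supplied by the planner `t4-ne9-idea-1` gen 9's QUADRATIC TEST
  `(μt′c̄)² ≤ (μt′(1−c̄²) − t′²)(1 − μt′)`, `μt′ < 1`, `t ≤ t′` (`NE9PolydiscStepOffCentre.rateIneq_of_quadTest`).
* §5 **`…_offCentre_exists`** — the ∃-FACE (idea-1's §7 shape; this lineage's gen-50 scratch E2E, CLAIMS.log 2026-08-21T09:5xZ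
  «RESULT 2»): `hΦoff : ∃ Φ₀, ‖Φ₀‖ ≤ P₀ ∧ MapsTo (ΦY k (g k)) (ball 0 r) (closedBall Φ₀ B₁)` + split rooms + quadratic test, through
  (T-a)'s `chainLipschitz_of_offCentreMaps_polydisc` ∘ (T-b)'s `offCentreMaps_step`.
* §6 junction `example`: at centres `0`, `cbar₀ = c̄ = 0`, `r₄ = θ·r`, `μ = θ` (`rateIneq_centred`) §1 gives back the ♯-END of
  record `…_injRead_SP`'s statement letter for letter — R4♯-T ⊇ R4♯ at the END of record.
DISGUISE TEST: an abstract functional with displayed binders, one slice map, one injection, generic SCV chain lemmas; no carriers of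
Bałaban's; not NE9.  WHAT THIS DOES NOT DO: discharge (Φ-holo) ∕ off-centre (Φ-size) ∕ (Φ-real) ∕ `hlast` (the owner's instance
clauses, (T-c) record half), touch W1 = (D1), (R-1a), or read the room N2 as a slack inequality of the series; R4's LIFE region is the
refuter's to price (PRICING-NE9 v11 (T) row) — only the rate letter moves here.

References (TYPES ∕ loci only): [Balaban1987RG1] T. Bałaban, CMP **109** (1987) 249–301 — (0.23) p. 256, (2.13) p. 268, (1.18)
p. 263; [Balaban1988RG2Cluster] T. Bałaban, CMP **116** (1988) 1–22 — (1.36) p. 9, (2.38)–(2.41) pp. 20–21; [FV1980] T. Franzoni,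
E. Vesentini, North-Holland Math. Studies 40 (1980) ch. IV–V; [Harris1979] L. A. Harris, North-Holland Math. Studies 34 (1979)
345–406; [EH1970] C. J. Earle, R. S. Hamilton, Proc. Sympos. Pure Math. XVI (1970) 61–65.  Summits-side NEW work (LEAN PLACEMENT
RULE); imports this lineage's `NE9FutureProfileEndOfRecordSP`, leaf-04's `NE9FutureProfileStepOffCentre` and leaf-03's
`NE9PolydiscChainOffCentre` BY NAME; modifies nothing; 0 sorry.  Value = the END of record's rate letter made translation-aware,
NOT summit progress.
-/

noncomputable section

namespace Summit.QuantumFields.BalabanUV.T4Continuum.NE9FutureProfileEndOfRecordOffCentre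

open Metric Set
open scoped BigOperators ENNReal
open Literature.MathematicalPhysics.QuantumFieldTheory.Balaban1983to89
open Literature.MathematicalPhysics.QuantumFieldTheory.Balaban1983to89.T4OutputRate
open Literature.MathematicalPhysics.QuantumFieldTheory.Balaban1983to89.T4HistoryLipschitzRecursion
open Literature.MathematicalPhysics.QuantumFieldTheory.Balaban1983to89.T4HistoryLipschitzOuter
open Summit.QuantumFields.BalabanUV.T4Continuum.NE9FutureProfileStep
open Summit.QuantumFields.BalabanUV.T4Continuum.NE9FutureProfileEnd
open Summit.QuantumFields.BalabanUV.T4Continuum.NE9ChannelRealLinear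
open Summit.QuantumFields.BalabanUV.T4Continuum.NE9SliceSpaceOfRecord
open Summit.QuantumFields.BalabanUV.T4Continuum.NE9ChannelReadingOfRecord
open Summit.QuantumFields.BalabanUV.T4Continuum.NE9ChannelReadingSharp
open Summit.QuantumFields.BalabanUV.T4Continuum.NE9TableReading
open Summit.QuantumFields.BalabanUV.T4Continuum.NE9FutureProfileRecordPrelim
open Summit.QuantumFields.BalabanUV.T4Continuum.NE9FutureProfileEndOfRecordSP
open Summit.QuantumFields.BalabanUV.T4Continuum.NE9FutureProfileStepOffCentre (differentiableOn_step mapsTo_step_offCentre_family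
  norm_centre_le_of_le mapsTo_centred_of_offCentre offCentreMaps_step)
open Summit.QuantumFields.BalabanUV.T4Continuum.NE9PolydiscStepOffCentre (rate_pos rateIneq_centred rateIneq_of_quadTest)
open Summit.QuantumFields.BalabanUV.T4Continuum.NE9PolydiscChainOffCentre (chainLipschitz_of_holoMaps_offCentre
  chainLipschitz_of_offCentreMaps_polydisc)
open Summit.QuantumFields.BalabanUV.T4Continuum.NE9StateLinftyEquiv (stateLinftyEquiv)

variable {C : Carriers} {Bg ι : Type}

section Record

variable [Nonempty ι] {E : Functional C Bg} {W : Set (ℕ → ℝ)} {Adm : Set (Bg → C.Dom → ℝ)}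
  {T : ℕ → (ℕ → ℝ) → (Bg → C.Dom → ℝ) → ι → ℝ} {Ψ : ℕ → ℝ → (ι → ℝ) → Bg → C.Dom → ℝ}
  {κ : ℝ} {wt : ℕ → ι → ℝ} {τ : ℕ → ℕ → ℝ} {τbar ω ωh : ℝ}

/-! ## §1 THE KERNEL FACE: a family of centres, split rooms, the interval test at `(r, c̄, r₄)` -/

/-- **ROUTE R4♯-T's END OF RECORD (kernel face).**  The END of record's structural binders VERBATIM (`h0` base-free histories —
printed structure [I] (0.23) p. 256 —, `AdmissibleTerms`, `AdmRestrict`, `ChannelAdditive`, `ChannelLocal`, `ChannelSizeAtStepNN` + `hτ`,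
`Factorises`, `LastCouplingLipschitz` + `hlam`, `hsmul`, `hne`, `hwt`, `hω`, `hωh`, `hωωh`, `0 < τ₀` + `hRd`), (Φ-holo) `hΦd`, the
OFF-CENTRE (Φ-size) `hΦoff : MapsTo (ΦY k (g k)) (ball 0 r) (closedBall (cY k g) B₁)` for a FAMILY of centres `cY k g` with
`‖cY k g‖ ≤ cbar₀` on the window, (Φ-real) `hreal`, the SPLIT rooms `ω̂·r + τ₀·B₁ ≤ r₄`, `τ₀·cbar₀ ≤ c̄`, `c̄ + r₄ ≤ θ·r` (`θ < 1`) and a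
rate `μ` passing the interval test `(r₄² − ρ²)·r ≤ μ·r₄·(r² − (c̄ + ρ)²)` on `[0, r₄]` ⊢
`NE9 E W κ (prodModuli (1∕(1−θ²)·ℓ) (fun _ ↦ μ)) ∧ FadingMemory (1∕(1−θ²)·ℓ∕μ) μ (…)`.  Proof: `…_injRead_of_chain` (p256694 §1) at
`hchain :=` (T-a) `chainLipschitz_of_holoMaps_offCentre` on the docking isometry `stateLinftyEquiv (Bg × C.Dom) (Idx W) ι` with centres
`c k g := (τ₀ • cY k g, J k (cY k g))`, `J := injRead (RdAmb …) …`, fed by (T-b)'s three suppliers `differentiableOn_step` ∕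
`mapsTo_step_offCentre_family` ∕ `norm_centre_le_of_le`; the END's centred (Φ-size) at `B₀ := cbar₀ + B₁` is (T-b)'s
`mapsTo_centred_of_offCentre`, its room and `0 < r₄`, `0 < μ` (`rate_pos`) are DERIVED.  «NE9 ⇐ the named binders»: the instance
clauses, (T-c)'s record half and W1 are untouched. [cite: Balaban1987RG1, (2.13) p.268; Balaban1988RG2Cluster, (1.36) p.9] -/
theorem ne9_and_fadingMemory_of_holoSlice_injRead_offCentre
    (h0 : ∀ g ∈ W, ∀ (U : Bg) (X : C.Dom), C.scale X = 0 → E g U X = 0)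
    (hAdm : AdmissibleTerms E W Adm) (hres : AdmRestrict Adm) (hadd : ChannelAdditive Adm T) (hloc : ChannelLocal Adm T)
    (hstep : ChannelSizeAtStepNN Adm T κ wt τ) (hfac : Factorises E W T Ψ) {lam : ℕ → ℝ}
    (hlast : LastCouplingLipschitz E W T Ψ κ lam)
    (hsmul : ∀ (c : ℝ), ∀ H ∈ Adm, c • H ∈ Adm) (hne : Adm.Nonempty) (hwt : ∀ m y, 0 < wt m y)
    (hτ : ∀ k j, j ≤ k → 0 ≤ τ k j ∧ τ k j ≤ τbar * ω ^ (k - j)) (hω : 0 ≤ ω) (hωh : 0 < ωh) (hωωh : ω ≤ ωh)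
    {τ₀ : ℝ} (hτ₀pos : 0 < τ₀)
    (hRd : ∀ (j n : ℕ), ∀ s ∈ W,
      ‖RdAmb (κ := κ) hadd hres hstep hAdm.2 hsmul hne hwt (τ_nonneg hτ) (j + n) j s‖ ≤ τ₀ * ω ^ n)
    {ΦY : ℕ → ℝ → lp (fun _ : ι => ℂ) ∞ → lp (fun _ : Bg × C.Dom => ℂ) ∞} {r B₁ cbar₀ cbar r₄ θ μ ℓ : ℝ} (hr : 0 < r)
    (hB₁ : 0 ≤ B₁) (hcbar₀ : 0 ≤ cbar₀) (hθ1 : θ < 1) (hℓ : 0 ≤ ℓ)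
    (hΦd : ∀ k, ∀ g ∈ W, DifferentiableOn ℂ (ΦY k (g k)) (ball (0 : lp (fun _ : ι => ℂ) ∞) r))
    (cY : ℕ → (ℕ → ℝ) → lp (fun _ : Bg × C.Dom => ℂ) ∞)
    (hΦoff : ∀ k, ∀ g ∈ W, MapsTo (ΦY k (g k)) (ball (0 : lp (fun _ : ι => ℂ) ∞) r) (closedBall (cY k g) B₁))
    (hcY : ∀ k, ∀ g ∈ W, ‖cY k g‖ ≤ cbar₀)
    (hreal : ∀ k, ∀ g ∈ W, ∀ s ∈ W, reading (wt k) (T k s (E g)) ∈ ball (0 : lp (fun _ : ι => ℂ) ∞) r →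
      ∀ (U : Bg) (X : C.Dom), (ΦY k (s k) (reading (wt k) (T k s (E g))) : Bg × C.Dom → ℂ) (U, X) =
        ((Real.exp (κ * C.d X) * restrictScale (k + 1) (Ψ k (s k) (T k s (E g))) U X : ℝ) : ℂ))
    (hr₄ : ωh * r + τ₀ * B₁ ≤ r₄) (hcbar : τ₀ * cbar₀ ≤ cbar) (hθ : cbar + r₄ ≤ θ * r)
    (hμ : ∀ ρ ∈ Icc (0 : ℝ) r₄, (r₄ ^ 2 - ρ ^ 2) * r ≤ μ * r₄ * (r ^ 2 - (cbar + ρ) ^ 2))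
    (hlam : ∀ k, lam k ≤ ℓ) :
    NE9 E W κ (prodModuli (1 / (1 - θ ^ 2) * ℓ) fun _ => μ) ∧
      FadingMemory (1 / (1 - θ ^ 2) * ℓ / μ) μ (prodModuli (1 / (1 - θ ^ 2) * ℓ) fun _ => μ) := by
  -- the injection of the record and its size
  have hJ : ∀ k, ‖injRead (W := W) (RdAmb (κ := κ) hadd hres hstep hAdm.2 hsmul hne hwt (τ_nonneg hτ)) hτ₀pos.le hω hωh
      hωωh hRd k‖ ≤ τ₀ := fun k => norm_injRead_le _ hτ₀pos.le hω hωh hωωh hRd k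
  -- DERIVED letters: `0 < r₄`, `0 ≤ c̄`, `c̄ + r₄ < r`, `0 < μ`, and the END's total room at `B₀ := cbar₀ + B₁`
  have hr₄pos : 0 < r₄ := lt_of_lt_of_le (by nlinarith [mul_pos hωh hr, mul_nonneg hτ₀pos.le hB₁]) hr₄
  have hcbar0 : 0 ≤ cbar := (mul_nonneg hτ₀pos.le hcbar₀).trans hcbar
  have h1 : cbar + r₄ < r := lt_of_le_of_lt hθ (by nlinarith)
  have hμ0 : 0 < μ := rate_pos hr hcbar0 hr₄pos h1 hμ
  have hroom : ωh * r + τ₀ * (cbar₀ + B₁) ≤ θ * r := by nlinarith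
  exact ne9_and_fadingMemory_of_holoSlice_injRead_of_chain h0 hAdm hres hadd hloc hstep hfac hlast hsmul hne hwt hτ hω hωh
    hωωh hτ₀pos hRd hr (add_nonneg hcbar₀ hB₁) hθ1 hℓ (one_div_nonneg.2 (by nlinarith)) hμ0
    (mapsTo_centred_of_offCentre cY hΦoff hcY) hreal hroom
    (chainLipschitz_of_holoMaps_offCentre (stateLinftyEquiv (Bg × C.Dom) (Idx W) ι)
      (fun k g => (((τ₀ : ℂ) • cY k g,
        injRead (W := W) (RdAmb (κ := κ) hadd hres hstep hAdm.2 hsmul hne hwt (τ_nonneg hτ)) hτ₀pos.le hω hωh hωωh hRd k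
          (cY k g)) : lp (fun _ : Bg × C.Dom => ℂ) ∞ × Fut W (lp (fun _ : ι => ℂ) ∞)))
      hr hr₄pos hθ hθ1 hμ (fun k g hg => differentiableOn_step hΦd k hg)
      (mapsTo_step_offCentre_family hτ₀pos.le hωh.le hJ cY hΦoff hr₄)
      (fun k g hg => (norm_centre_le_of_le hτ₀pos.le hJ cY hcY k g hg).trans hcbar))
    hlam

/-! ## §2 HISTORY-FREE centres (the record's case) -/

/-- **ROUTE R4♯-T's END OF RECORD, HISTORY-FREE CENTRES** — §1 at the constant family `fun k _ ↦ cY k` with `‖cY k‖ ≤ cbar₀` for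
all `k` (OWNER g62 (W3)∕(W4): on the record `cY k` = the `explZ` part of the vacuum-subtracted slice — history-free BY TYPE —,
`B₁ = 2B`, `cbar₀ = p̄₀`; the record clause `NE9HoloFamilyOffCentre.vacSlice_offCentre_of_potentialKPG` delivers exactly
`hΦd`∕`hΦoff`∕`hcY`).  «NE9 ⇐ the named binders». [cite: Balaban1987RG1, (2.13) p.268; Balaban1988RG2Cluster, (1.36) p.9] -/
theorem ne9_and_fadingMemory_of_holoSlice_injRead_offCentre_free
    (h0 : ∀ g ∈ W, ∀ (U : Bg) (X : C.Dom), C.scale X = 0 → E g U X = 0)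
    (hAdm : AdmissibleTerms E W Adm) (hres : AdmRestrict Adm) (hadd : ChannelAdditive Adm T) (hloc : ChannelLocal Adm T)
    (hstep : ChannelSizeAtStepNN Adm T κ wt τ) (hfac : Factorises E W T Ψ) {lam : ℕ → ℝ}
    (hlast : LastCouplingLipschitz E W T Ψ κ lam)
    (hsmul : ∀ (c : ℝ), ∀ H ∈ Adm, c • H ∈ Adm) (hne : Adm.Nonempty) (hwt : ∀ m y, 0 < wt m y)
    (hτ : ∀ k j, j ≤ k → 0 ≤ τ k j ∧ τ k j ≤ τbar * ω ^ (k - j)) (hω : 0 ≤ ω) (hωh : 0 < ωh) (hωωh : ω ≤ ωh)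
    {τ₀ : ℝ} (hτ₀pos : 0 < τ₀)
    (hRd : ∀ (j n : ℕ), ∀ s ∈ W,
      ‖RdAmb (κ := κ) hadd hres hstep hAdm.2 hsmul hne hwt (τ_nonneg hτ) (j + n) j s‖ ≤ τ₀ * ω ^ n)
    {ΦY : ℕ → ℝ → lp (fun _ : ι => ℂ) ∞ → lp (fun _ : Bg × C.Dom => ℂ) ∞} {r B₁ cbar₀ cbar r₄ θ μ ℓ : ℝ} (hr : 0 < r)
    (hB₁ : 0 ≤ B₁) (hcbar₀ : 0 ≤ cbar₀) (hθ1 : θ < 1) (hℓ : 0 ≤ ℓ)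
    (hΦd : ∀ k, ∀ g ∈ W, DifferentiableOn ℂ (ΦY k (g k)) (ball (0 : lp (fun _ : ι => ℂ) ∞) r))
    (cY : ℕ → lp (fun _ : Bg × C.Dom => ℂ) ∞)
    (hΦoff : ∀ k, ∀ g ∈ W, MapsTo (ΦY k (g k)) (ball (0 : lp (fun _ : ι => ℂ) ∞) r) (closedBall (cY k) B₁))
    (hcY : ∀ k, ‖cY k‖ ≤ cbar₀)
    (hreal : ∀ k, ∀ g ∈ W, ∀ s ∈ W, reading (wt k) (T k s (E g)) ∈ ball (0 : lp (fun _ : ι => ℂ) ∞) r →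
      ∀ (U : Bg) (X : C.Dom), (ΦY k (s k) (reading (wt k) (T k s (E g))) : Bg × C.Dom → ℂ) (U, X) =
        ((Real.exp (κ * C.d X) * restrictScale (k + 1) (Ψ k (s k) (T k s (E g))) U X : ℝ) : ℂ))
    (hr₄ : ωh * r + τ₀ * B₁ ≤ r₄) (hcbar : τ₀ * cbar₀ ≤ cbar) (hθ : cbar + r₄ ≤ θ * r)
    (hμ : ∀ ρ ∈ Icc (0 : ℝ) r₄, (r₄ ^ 2 - ρ ^ 2) * r ≤ μ * r₄ * (r ^ 2 - (cbar + ρ) ^ 2))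
    (hlam : ∀ k, lam k ≤ ℓ) :
    NE9 E W κ (prodModuli (1 / (1 - θ ^ 2) * ℓ) fun _ => μ) ∧
      FadingMemory (1 / (1 - θ ^ 2) * ℓ / μ) μ (prodModuli (1 / (1 - θ ^ 2) * ℓ) fun _ => μ) :=
  ne9_and_fadingMemory_of_holoSlice_injRead_offCentre h0 hAdm hres hadd hloc hstep hfac hlast hsmul hne hwt hτ hω hωh hωωh hτ₀pos
    hRd hr hB₁ hcbar₀ hθ1 hℓ hΦd (fun k _ => cY k) hΦoff (fun k _ _ => hcY k) hreal hr₄ hcbar hθ hμ hlam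

/-! ## §3 NORMALISED SPLIT-ROOM LETTERS `(t, c̄)`, `θ = c̄ + t` (the owner's announced §2 ∕ the refuter's §E) -/

/-- **ROUTE R4♯-T's END OF RECORD, NORMALISED LETTERS** — history-free centres; rooms `ω̂·r + τ₀·B₁ ≤ t·r`, `τ₀·cbar₀ ≤ c̄·r`,
`c̄ + t = θ` (`θ < 1`); interval test at `(r, c̄·r, t·r)`: `((t·r)² − ρ²)·r ≤ μ·(t·r)·(r² − (c̄·r + ρ)²)` on `[0, t·r]` ⊢ the §1 moduli
at rate `μ`.  On the record (OWNER g62 (W4), refuter PRICING-NE9 v10 §E): `r = R₀`, `B₁ = 2B`, `cbar₀ = p̄₀`, `τ₀ = τ̄`.  §2 at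
`r₄ := t·r`, `c̄ := c̄·r`.  «NE9 ⇐ the named binders». [cite: Balaban1987RG1, (2.13) p.268; Balaban1988RG2Cluster, (1.36) p.9] -/
theorem ne9_and_fadingMemory_of_holoSlice_injRead_offCentre_split
    (h0 : ∀ g ∈ W, ∀ (U : Bg) (X : C.Dom), C.scale X = 0 → E g U X = 0)
    (hAdm : AdmissibleTerms E W Adm) (hres : AdmRestrict Adm) (hadd : ChannelAdditive Adm T) (hloc : ChannelLocal Adm T)
    (hstep : ChannelSizeAtStepNN Adm T κ wt τ) (hfac : Factorises E W T Ψ) {lam : ℕ → ℝ}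
    (hlast : LastCouplingLipschitz E W T Ψ κ lam)
    (hsmul : ∀ (c : ℝ), ∀ H ∈ Adm, c • H ∈ Adm) (hne : Adm.Nonempty) (hwt : ∀ m y, 0 < wt m y)
    (hτ : ∀ k j, j ≤ k → 0 ≤ τ k j ∧ τ k j ≤ τbar * ω ^ (k - j)) (hω : 0 ≤ ω) (hωh : 0 < ωh) (hωωh : ω ≤ ωh)
    {τ₀ : ℝ} (hτ₀pos : 0 < τ₀)
    (hRd : ∀ (j n : ℕ), ∀ s ∈ W,
      ‖RdAmb (κ := κ) hadd hres hstep hAdm.2 hsmul hne hwt (τ_nonneg hτ) (j + n) j s‖ ≤ τ₀ * ω ^ n)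
    {ΦY : ℕ → ℝ → lp (fun _ : ι => ℂ) ∞ → lp (fun _ : Bg × C.Dom => ℂ) ∞} {r B₁ cbar₀ cb t θ μ ℓ : ℝ} (hr : 0 < r)
    (hB₁ : 0 ≤ B₁) (hcbar₀ : 0 ≤ cbar₀) (hθ1 : θ < 1) (hℓ : 0 ≤ ℓ)
    (hΦd : ∀ k, ∀ g ∈ W, DifferentiableOn ℂ (ΦY k (g k)) (ball (0 : lp (fun _ : ι => ℂ) ∞) r))
    (cY : ℕ → lp (fun _ : Bg × C.Dom => ℂ) ∞)
    (hΦoff : ∀ k, ∀ g ∈ W, MapsTo (ΦY k (g k)) (ball (0 : lp (fun _ : ι => ℂ) ∞) r) (closedBall (cY k) B₁))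
    (hcY : ∀ k, ‖cY k‖ ≤ cbar₀)
    (hreal : ∀ k, ∀ g ∈ W, ∀ s ∈ W, reading (wt k) (T k s (E g)) ∈ ball (0 : lp (fun _ : ι => ℂ) ∞) r →
      ∀ (U : Bg) (X : C.Dom), (ΦY k (s k) (reading (wt k) (T k s (E g))) : Bg × C.Dom → ℂ) (U, X) =
        ((Real.exp (κ * C.d X) * restrictScale (k + 1) (Ψ k (s k) (T k s (E g))) U X : ℝ) : ℂ))
    (ht : ωh * r + τ₀ * B₁ ≤ t * r) (hcb : τ₀ * cbar₀ ≤ cb * r) (hθ : cb + t = θ)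
    (hμ : ∀ ρ ∈ Icc (0 : ℝ) (t * r), ((t * r) ^ 2 - ρ ^ 2) * r ≤ μ * (t * r) * (r ^ 2 - (cb * r + ρ) ^ 2))
    (hlam : ∀ k, lam k ≤ ℓ) :
    NE9 E W κ (prodModuli (1 / (1 - θ ^ 2) * ℓ) fun _ => μ) ∧
      FadingMemory (1 / (1 - θ ^ 2) * ℓ / μ) μ (prodModuli (1 / (1 - θ ^ 2) * ℓ) fun _ => μ) :=
  ne9_and_fadingMemory_of_holoSlice_injRead_offCentre_free h0 hAdm hres hadd hloc hstep hfac hlast hsmul hne hwt hτ hω hωh hωωh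
    hτ₀pos hRd hr hB₁ hcbar₀ hθ1 hℓ hΦd cY hΦoff hcY hreal ht hcb (le_of_eq (by rw [← hθ, add_mul])) hμ hlam

/-! ## §3′ `τ₀ := τ̄` — the `√2`-free reading constant of the ♯-END of record (E134-type ENDs dock here by ONE name) -/

/-- **ROUTE R4♯-T's END OF RECORD WITH `τ₀ := τ̄`, NORMALISED LETTERS** — §3 with the reading constant `τ̄` and
`hRd := NE9ChannelReadingSharp.norm_RdAmb_le_geometric_sharp` supplied (exactly as `…_sharp_SP` is `…_injRead_SP` at `τ₀ := τ̄`):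
binders = `NE9FutureProfileEndOfRecordSP.ne9_and_fadingMemory_of_holoSlice_sharp_SP`'s with (Φ-size) `hΦb` REPLACED by the history-free
off-centre datum `(cY, hΦoff, hcY)`, `hB₀` by `(hB₁, hcbar₀)`, `hθ0` dropped, the room `ω̂·r + τ̄·B₀ ≤ θ·r` by `ω̂·r + τ̄·B₁ ≤ t·r`,
`τ̄·cbar₀ ≤ c̄·r`, `c̄ + t = θ` + the interval test at `(r, c̄·r, t·r)`.  THE OWNER's RE-DOCK POINT: E134 §2
`NE9HoloFamilyCoupledEndSharp2.ne9_and_fadingMemory_of_potentialKPG_coupling_SP_vac` ends in `exact …_of_holoSlice_sharp_SP …`; its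
off-centre twin ends in `exact …_of_holoSlice_offCentre_sharp_split …` fed by (T-c) `NE9HoloFamilyOffCentre.vacSlice_offCentre_of_potentialKPG`
(`r := s₀`, `B₁ := 2B`, `cbar₀ := p̄₀`).  «NE9 ⇐ the named binders». [cite: Balaban1987RG1, (2.13) p.268; Balaban1988RG2Cluster, (1.36) p.9] -/
theorem ne9_and_fadingMemory_of_holoSlice_offCentre_sharp_split
    (h0 : ∀ g ∈ W, ∀ (U : Bg) (X : C.Dom), C.scale X = 0 → E g U X = 0)
    (hAdm : AdmissibleTerms E W Adm) (hres : AdmRestrict Adm) (hadd : ChannelAdditive Adm T) (hloc : ChannelLocal Adm T)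
    (hstep : ChannelSizeAtStepNN Adm T κ wt τ) (hfac : Factorises E W T Ψ) {lam : ℕ → ℝ}
    (hlast : LastCouplingLipschitz E W T Ψ κ lam)
    (hsmul : ∀ (c : ℝ), ∀ H ∈ Adm, c • H ∈ Adm) (hne : Adm.Nonempty) (hwt : ∀ m y, 0 < wt m y)
    (hτ : ∀ k j, j ≤ k → 0 ≤ τ k j ∧ τ k j ≤ τbar * ω ^ (k - j)) (hτbar : 0 < τbar) (hω : 0 ≤ ω) (hωh : 0 < ωh)
    (hωωh : ω ≤ ωh) {ΦY : ℕ → ℝ → lp (fun _ : ι => ℂ) ∞ → lp (fun _ : Bg × C.Dom => ℂ) ∞} {r B₁ cbar₀ cb t θ μ ℓ : ℝ}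
    (hr : 0 < r) (hB₁ : 0 ≤ B₁) (hcbar₀ : 0 ≤ cbar₀) (hθ1 : θ < 1) (hℓ : 0 ≤ ℓ)
    (hΦd : ∀ k, ∀ g ∈ W, DifferentiableOn ℂ (ΦY k (g k)) (ball (0 : lp (fun _ : ι => ℂ) ∞) r))
    (cY : ℕ → lp (fun _ : Bg × C.Dom => ℂ) ∞)
    (hΦoff : ∀ k, ∀ g ∈ W, MapsTo (ΦY k (g k)) (ball (0 : lp (fun _ : ι => ℂ) ∞) r) (closedBall (cY k) B₁))
    (hcY : ∀ k, ‖cY k‖ ≤ cbar₀)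
    (hreal : ∀ k, ∀ g ∈ W, ∀ s ∈ W, reading (wt k) (T k s (E g)) ∈ ball (0 : lp (fun _ : ι => ℂ) ∞) r →
      ∀ (U : Bg) (X : C.Dom), (ΦY k (s k) (reading (wt k) (T k s (E g))) : Bg × C.Dom → ℂ) (U, X) =
        ((Real.exp (κ * C.d X) * restrictScale (k + 1) (Ψ k (s k) (T k s (E g))) U X : ℝ) : ℂ))
    (ht : ωh * r + τbar * B₁ ≤ t * r) (hcb : τbar * cbar₀ ≤ cb * r) (hθ : cb + t = θ)
    (hμ : ∀ ρ ∈ Icc (0 : ℝ) (t * r), ((t * r) ^ 2 - ρ ^ 2) * r ≤ μ * (t * r) * (r ^ 2 - (cb * r + ρ) ^ 2))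
    (hlam : ∀ k, lam k ≤ ℓ) :
    NE9 E W κ (prodModuli (1 / (1 - θ ^ 2) * ℓ) fun _ => μ) ∧
      FadingMemory (1 / (1 - θ ^ 2) * ℓ / μ) μ (prodModuli (1 / (1 - θ ^ 2) * ℓ) fun _ => μ) :=
  ne9_and_fadingMemory_of_holoSlice_injRead_offCentre_split h0 hAdm hres hadd hloc hstep hfac hlast hsmul hne hwt hτ hω hωh hωωh
    hτbar (fun j n s _ => norm_RdAmb_le_geometric_sharp (τ_geom hτ) j n s) hr hB₁ hcbar₀ hθ1 hℓ hΦd cY hΦoff hcY hreal ht hcb hθ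
    hμ hlam

/-! ## §4 The quadratic test (planner `t4-ne9-idea-1` gen 9) supplies the interval test -/

/-- **ROUTE R4♯-T's END OF RECORD AT THE QUADRATIC TEST** — §3's binder list with the interval test REPLACED by the planner's
quadratic test at `(c̄, t′, μ)`: `t ≤ t′`, `μ·t′ < 1`, `(μ·t′·c̄)² ≤ (μ·t′·(1 − c̄²) − t′²)·(1 − μ·t′)`
(`NE9PolydiscStepOffCentre.rateIneq_of_quadTest`; `0 < t` is DERIVED from the room).  A `norm_num` certificate at rational letters
discharges the test; the least admissible `μ` is the refuter's `λ*`.  «NE9 ⇐ the named binders».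
[cite: Balaban1987RG1, (2.13) p.268; Balaban1988RG2Cluster, (1.36) p.9] -/
theorem ne9_and_fadingMemory_of_holoSlice_injRead_offCentre_quadTest
    (h0 : ∀ g ∈ W, ∀ (U : Bg) (X : C.Dom), C.scale X = 0 → E g U X = 0)
    (hAdm : AdmissibleTerms E W Adm) (hres : AdmRestrict Adm) (hadd : ChannelAdditive Adm T) (hloc : ChannelLocal Adm T)
    (hstep : ChannelSizeAtStepNN Adm T κ wt τ) (hfac : Factorises E W T Ψ) {lam : ℕ → ℝ}
    (hlast : LastCouplingLipschitz E W T Ψ κ lam)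
    (hsmul : ∀ (c : ℝ), ∀ H ∈ Adm, c • H ∈ Adm) (hne : Adm.Nonempty) (hwt : ∀ m y, 0 < wt m y)
    (hτ : ∀ k j, j ≤ k → 0 ≤ τ k j ∧ τ k j ≤ τbar * ω ^ (k - j)) (hω : 0 ≤ ω) (hωh : 0 < ωh) (hωωh : ω ≤ ωh)
    {τ₀ : ℝ} (hτ₀pos : 0 < τ₀)
    (hRd : ∀ (j n : ℕ), ∀ s ∈ W,
      ‖RdAmb (κ := κ) hadd hres hstep hAdm.2 hsmul hne hwt (τ_nonneg hτ) (j + n) j s‖ ≤ τ₀ * ω ^ n)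
    {ΦY : ℕ → ℝ → lp (fun _ : ι => ℂ) ∞ → lp (fun _ : Bg × C.Dom => ℂ) ∞} {r B₁ cbar₀ cb t t' θ μ ℓ : ℝ} (hr : 0 < r)
    (hB₁ : 0 ≤ B₁) (hcbar₀ : 0 ≤ cbar₀) (hθ1 : θ < 1) (hℓ : 0 ≤ ℓ) (htt' : t ≤ t') (hlt : μ * t' < 1)
    (hquad : (μ * t' * cb) ^ 2 ≤ (μ * t' * (1 - cb ^ 2) - t' ^ 2) * (1 - μ * t'))
    (hΦd : ∀ k, ∀ g ∈ W, DifferentiableOn ℂ (ΦY k (g k)) (ball (0 : lp (fun _ : ι => ℂ) ∞) r))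
    (cY : ℕ → lp (fun _ : Bg × C.Dom => ℂ) ∞)
    (hΦoff : ∀ k, ∀ g ∈ W, MapsTo (ΦY k (g k)) (ball (0 : lp (fun _ : ι => ℂ) ∞) r) (closedBall (cY k) B₁))
    (hcY : ∀ k, ‖cY k‖ ≤ cbar₀)
    (hreal : ∀ k, ∀ g ∈ W, ∀ s ∈ W, reading (wt k) (T k s (E g)) ∈ ball (0 : lp (fun _ : ι => ℂ) ∞) r →
      ∀ (U : Bg) (X : C.Dom), (ΦY k (s k) (reading (wt k) (T k s (E g))) : Bg × C.Dom → ℂ) (U, X) =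
        ((Real.exp (κ * C.d X) * restrictScale (k + 1) (Ψ k (s k) (T k s (E g))) U X : ℝ) : ℂ))
    (ht : ωh * r + τ₀ * B₁ ≤ t * r) (hcb : τ₀ * cbar₀ ≤ cb * r) (hθ : cb + t = θ) (hlam : ∀ k, lam k ≤ ℓ) :
    NE9 E W κ (prodModuli (1 / (1 - θ ^ 2) * ℓ) fun _ => μ) ∧
      FadingMemory (1 / (1 - θ ^ 2) * ℓ / μ) μ (prodModuli (1 / (1 - θ ^ 2) * ℓ) fun _ => μ) :=
  have ht0 : 0 < t := by
    have h1 : 0 * r < t * r := lt_of_lt_of_le (by nlinarith [mul_pos hωh hr, mul_nonneg hτ₀pos.le hB₁]) ht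
    exact lt_of_mul_lt_mul_right h1 hr.le
  ne9_and_fadingMemory_of_holoSlice_injRead_offCentre_split h0 hAdm hres hadd hloc hstep hfac hlast hsmul hne hwt hτ hω hωh hωωh
    hτ₀pos hRd hr hB₁ hcbar₀ hθ1 hℓ hΦd cY hΦoff hcY hreal ht hcb hθ (rateIneq_of_quadTest hr ht0 htt' hlt hquad) hlam

/-! ## §5 THE ∃-FACE (idea-1's §7 shape; this lineage's gen-50 scratch E2E on TREE names) -/

/-- **ROUTE R4♯-T's END OF RECORD, ∃-FACE** — the off-centre (Φ-size) in the form «image in SOME ball `B̄(Φ₀, B₁)` with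
`‖Φ₀‖ ≤ P₀`» (centre may depend on the step AND the history), the split rooms `ω̂·r + τ₀·B₁ ≤ t·r`, `τ₀·P₀ ≤ c̄·r`, `c̄ + t = θ`
and the quadratic test at `(c̄, t′, μ)` (`t < t′`, `c̄ + t′ ≤ 1`) ⊢ the §1 moduli at rate `μ`: `…_injRead_of_chain` at (T-a)'s
∃-form `chainLipschitz_of_offCentreMaps_polydisc` ∘ (T-b)'s `offCentreMaps_step` (= planner `t4-ne9-idea-1` gen 9's §5 ∘ §7,
HOME scratch `t4/ideate/NE9/lens1-NE9OffCentreChain.lean` sha16 409b85d4eb69d683, on tree names), the END's centred (Φ-size) at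
`B₀ := P₀ + B₁` and its room derived.  «NE9 ⇐ the named binders». [cite: Balaban1987RG1, (2.13) p.268; Balaban1988RG2Cluster, (1.36) p.9] -/
theorem ne9_and_fadingMemory_of_holoSlice_injRead_offCentre_exists
    (h0 : ∀ g ∈ W, ∀ (U : Bg) (X : C.Dom), C.scale X = 0 → E g U X = 0)
    (hAdm : AdmissibleTerms E W Adm) (hres : AdmRestrict Adm) (hadd : ChannelAdditive Adm T) (hloc : ChannelLocal Adm T)
    (hstep : ChannelSizeAtStepNN Adm T κ wt τ) (hfac : Factorises E W T Ψ) {lam : ℕ → ℝ}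
    (hlast : LastCouplingLipschitz E W T Ψ κ lam)
    (hsmul : ∀ (c : ℝ), ∀ H ∈ Adm, c • H ∈ Adm) (hne : Adm.Nonempty) (hwt : ∀ m y, 0 < wt m y)
    (hτ : ∀ k j, j ≤ k → 0 ≤ τ k j ∧ τ k j ≤ τbar * ω ^ (k - j)) (hω : 0 ≤ ω) (hωh : 0 < ωh) (hωωh : ω ≤ ωh)
    {τ₀ : ℝ} (hτ₀pos : 0 < τ₀)
    (hRd : ∀ (j n : ℕ), ∀ s ∈ W,
      ‖RdAmb (κ := κ) hadd hres hstep hAdm.2 hsmul hne hwt (τ_nonneg hτ) (j + n) j s‖ ≤ τ₀ * ω ^ n)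
    {ΦY : ℕ → ℝ → lp (fun _ : ι => ℂ) ∞ → lp (fun _ : Bg × C.Dom => ℂ) ∞} {r P₀ B₁ t t' cb μ θ ℓ : ℝ} (hr : 0 < r)
    (hP₀ : 0 ≤ P₀) (hB₁ : 0 ≤ B₁) (htt' : t < t') (hcb1 : cb + t' ≤ 1) (hlt : μ * t' < 1)
    (hquad : (μ * t' * cb) ^ 2 ≤ (μ * t' * (1 - cb ^ 2) - t' ^ 2) * (1 - μ * t')) (hθ : cb + t = θ) (hℓ : 0 ≤ ℓ)
    (hΦd : ∀ k, ∀ g ∈ W, DifferentiableOn ℂ (ΦY k (g k)) (ball (0 : lp (fun _ : ι => ℂ) ∞) r))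
    (hΦoff : ∀ k, ∀ g ∈ W, ∃ Φ₀ : lp (fun _ : Bg × C.Dom => ℂ) ∞, ‖Φ₀‖ ≤ P₀ ∧
      MapsTo (ΦY k (g k)) (ball (0 : lp (fun _ : ι => ℂ) ∞) r) (closedBall Φ₀ B₁))
    (hreal : ∀ k, ∀ g ∈ W, ∀ s ∈ W, reading (wt k) (T k s (E g)) ∈ ball (0 : lp (fun _ : ι => ℂ) ∞) r →
      ∀ (U : Bg) (X : C.Dom), (ΦY k (s k) (reading (wt k) (T k s (E g))) : Bg × C.Dom → ℂ) (U, X) =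
        ((Real.exp (κ * C.d X) * restrictScale (k + 1) (Ψ k (s k) (T k s (E g))) U X : ℝ) : ℂ))
    (ht : ωh * r + τ₀ * B₁ ≤ t * r) (hcb : τ₀ * P₀ ≤ cb * r) (hlam : ∀ k, lam k ≤ ℓ) :
    NE9 E W κ (prodModuli (1 / (1 - θ ^ 2) * ℓ) fun _ => μ) ∧
      FadingMemory (1 / (1 - θ ^ 2) * ℓ / μ) μ (prodModuli (1 / (1 - θ ^ 2) * ℓ) fun _ => μ) := by
  -- the CENTRED consequence of the off-centre (Φ-size): `closedBall Φ₀ B₁ ⊆ closedBall 0 (P₀ + B₁)`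
  have hΦb : ∀ k, ∀ g ∈ W, MapsTo (ΦY k (g k)) (ball (0 : lp (fun _ : ι => ℂ) ∞) r) (closedBall 0 (P₀ + B₁)) := by
    intro k g hg
    obtain ⟨Φ₀, hΦ₀, hm⟩ := hΦoff k g hg
    exact NE9FutureProfileStepOffCentre.mapsTo_closedBall_zero_of_offCentre hm hΦ₀
  -- DERIVED letters
  have ht0 : 0 < t := by
    have h1 : 0 * r < t * r := lt_of_lt_of_le (by nlinarith [mul_pos hωh hr, mul_nonneg hτ₀pos.le hB₁]) ht
    exact lt_of_mul_lt_mul_right h1 hr.le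
  have hcb0 : 0 ≤ cb := by
    have h1 : 0 * r ≤ cb * r := (zero_mul r).le.trans ((mul_nonneg hτ₀pos.le hP₀).trans hcb)
    exact le_of_mul_le_mul_right h1 hr
  have hθ1 : θ < 1 := by rw [← hθ]; linarith
  have hμ0 : 0 < μ :=
    rate_pos hr (mul_nonneg hcb0 hr.le) (mul_pos ht0 hr) (by rw [← add_mul]; nlinarith)
      (rateIneq_of_quadTest hr ht0 htt'.le hlt hquad)
  have hroom : ωh * r + τ₀ * (P₀ + B₁) ≤ θ * r := by rw [← hθ]; nlinarith
  exact ne9_and_fadingMemory_of_holoSlice_injRead_of_chain h0 hAdm hres hadd hloc hstep hfac hlast hsmul hne hwt hτ hω hωh hωωh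
    hτ₀pos hRd hr (add_nonneg hP₀ hB₁) hθ1 hℓ (one_div_nonneg.2 (by nlinarith)) hμ0 hΦb hreal hroom
    (chainLipschitz_of_offCentreMaps_polydisc (stateLinftyEquiv (Bg × C.Dom) (Idx W) ι) hr (mul_pos ht0 hr)
      (by rw [← hθ, add_mul]) hθ1 (rateIneq_of_quadTest hr ht0 htt'.le hlt hquad)
      (offCentreMaps_step hτ₀pos.le hωh.le hΦd hΦoff (fun k => norm_injRead_le _ hτ₀pos.le hω hωh hωωh hRd k) ht hcb))
    hlam

/-! ## §6 Junction (an `example`): the ♯-END of record is §1 at centres `0` -/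

/-- JUNCTION.  At centres `0`, `cbar₀ = c̄ = 0`, `r₄ = θ·r`, `μ = θ` (`NE9PolydiscStepOffCentre.rateIneq_centred`) the kernel face §1
gives back `NE9FutureProfileEndOfRecordSP.ne9_and_fadingMemory_of_holoSlice_injRead_SP`'s statement (p256694 §2) letter for letter —
checked by `exact` as an `example` (the gate forbids re-declaring a landed statement): R4♯-T ⊇ R4♯ at the END of record. [folklore] -/
example (h0 : ∀ g ∈ W, ∀ (U : Bg) (X : C.Dom), C.scale X = 0 → E g U X = 0)
    (hAdm : AdmissibleTerms E W Adm) (hres : AdmRestrict Adm) (hadd : ChannelAdditive Adm T) (hloc : ChannelLocal Adm T)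
    (hstep : ChannelSizeAtStepNN Adm T κ wt τ) (hfac : Factorises E W T Ψ) {lam : ℕ → ℝ}
    (hlast : LastCouplingLipschitz E W T Ψ κ lam)
    (hsmul : ∀ (c : ℝ), ∀ H ∈ Adm, c • H ∈ Adm) (hne : Adm.Nonempty) (hwt : ∀ m y, 0 < wt m y)
    (hτ : ∀ k j, j ≤ k → 0 ≤ τ k j ∧ τ k j ≤ τbar * ω ^ (k - j)) (hω : 0 ≤ ω) (hωh : 0 < ωh) (hωωh : ω ≤ ωh)
    {τ₀ : ℝ} (hτ₀pos : 0 < τ₀)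
    (hRd : ∀ (j n : ℕ), ∀ s ∈ W,
      ‖RdAmb (κ := κ) hadd hres hstep hAdm.2 hsmul hne hwt (τ_nonneg hτ) (j + n) j s‖ ≤ τ₀ * ω ^ n)
    {ΦY : ℕ → ℝ → lp (fun _ : ι => ℂ) ∞ → lp (fun _ : Bg × C.Dom => ℂ) ∞} {r B₀ θ ℓ : ℝ} (hr : 0 < r)
    (hB₀ : 0 ≤ B₀) (hθ0 : 0 < θ) (hθ1 : θ < 1) (hℓ : 0 ≤ ℓ)
    (hΦd : ∀ k, ∀ g ∈ W, DifferentiableOn ℂ (ΦY k (g k)) (ball (0 : lp (fun _ : ι => ℂ) ∞) r))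
    (hΦb : ∀ k, ∀ g ∈ W, MapsTo (ΦY k (g k)) (ball (0 : lp (fun _ : ι => ℂ) ∞) r) (closedBall 0 B₀))
    (hreal : ∀ k, ∀ g ∈ W, ∀ s ∈ W, reading (wt k) (T k s (E g)) ∈ ball (0 : lp (fun _ : ι => ℂ) ∞) r →
      ∀ (U : Bg) (X : C.Dom), (ΦY k (s k) (reading (wt k) (T k s (E g))) : Bg × C.Dom → ℂ) (U, X) =
        ((Real.exp (κ * C.d X) * restrictScale (k + 1) (Ψ k (s k) (T k s (E g))) U X : ℝ) : ℂ))
    (hroom : ωh * r + τ₀ * B₀ ≤ θ * r) (hlam : ∀ k, lam k ≤ ℓ) :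
    NE9 E W κ (prodModuli (1 / (1 - θ ^ 2) * ℓ) fun _ => θ) ∧
      FadingMemory (1 / (1 - θ ^ 2) * ℓ / θ) θ (prodModuli (1 / (1 - θ ^ 2) * ℓ) fun _ => θ) :=
  ne9_and_fadingMemory_of_holoSlice_injRead_offCentre_free h0 hAdm hres hadd hloc hstep hfac hlast hsmul hne hwt hτ hω hωh hωωh
    hτ₀pos hRd hr hB₀ le_rfl hθ1 hℓ hΦd (fun _ => 0) hΦb (fun _ => by rw [norm_zero]) hreal hroom
    (le_of_eq (by rw [mul_zero])) (le_of_eq (by rw [zero_add])) (rateIneq_centred hr hθ0.le hθ1) hlam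

end Record

/-! ## §7 Arithmetic at the refuter's table-H letters (pure numbers; a READING of [II] p. 21, asserted of nothing) -/

/-- ARITHMETIC (PRICING-NE9 v10 (E10-2), pure numbers): at `r = 1`, `t = ω̂ + τ̄·2B = 17∕52`, `c̄ = τ̄·p̄₀ = 1∕4`, `θ = c̄ + t = 15∕26`
the rate `μ = 44∕125 = 0.352` passes §3's interval test (the refuter's grid supremum `0.3518`), against the centred END's rate
`θ = 15∕26 ≈ 0.577`; prefactor `1∕(1−θ²) = 676∕451` unchanged.  A READING of [II] p. 21 ∕ p. 8, asserted of nothing. [folklore] -/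
example : (∀ ρ ∈ Icc (0 : ℝ) (17 / 52 * 1),
    ((17 / 52 * 1 : ℝ) ^ 2 - ρ ^ 2) * 1 ≤ 44 / 125 * (17 / 52 * 1) * (1 ^ 2 - (1 / 4 * 1 + ρ) ^ 2)) ∧
    (1 : ℝ) / 4 + 17 / 52 = 15 / 26 ∧ (44 : ℝ) / 125 < 15 / 26 ∧ (1 : ℝ) / (1 - (15 / 26) ^ 2) = 676 / 451 := by
  refine ⟨fun ρ hρ => ?_, by norm_num, by norm_num, by norm_num⟩
  nlinarith [sq_nonneg (ρ - 13 / 400), hρ.1, hρ.2]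

end Summit.QuantumFields.BalabanUV.T4Continuum.NE9FutureProfileEndOfRecordOffCentre

end
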